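import Mathlib
import Summits.Ventures.PercRepro.TriangleCapGraph

/-!
# PercRepro — the graphic closed form for ALL finite simple graphs: `T(G) ≤ P_KK(e − n + c)` (p3, gen 24)

`card_triangles_le_P` (`TriangleCapGraph`) bounds the triangles of a CONNECTED graph by `P (e + 1 − n)`. Here the
connectivity hypothesis is removed: with `c = #components` (Mathlib's `G.ConnectedComponent`), every finite simple
graph satisfies `#(G.cliqueFinset 3) ≤ P (e + c − n)` — `e − n + c` is the cyclomatic number of `G`
(`card_triangles_le_P_general`).
PROOF: the vertex set of a component (`compSet`) satisfies the cut criterion (`isConn_compSet`, a boundary dart of a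
walk inside the component), the `k`-cliques (`k ≥ 1`) of `G` are the disjoint union of those of the components
(`card_cliques_univ_eq_sum`), `main_aux` applies to each component, and `P` is superadditive
(`KK.P_superadd`, summed: `KK.sum_P_le`): `Σ_c T_c ≤ Σ_c P (ν_c) ≤ P (Σ_c ν_c) = P (e + c − n)`.
Axioms: standard.
-/

namespace PercRepro

namespace TriangleCap

namespace KK

open Finset

/-- Superadditivity of `P` over a finite sum: `Σ_{c ∈ s} P (f c) ≤ P (Σ_{c ∈ s} f c)`. -/
theorem sum_P_le {ι : Type*} (s : Finset ι) (f : ι → ℕ) : ∑ c ∈ s, P (f c) ≤ P (∑ c ∈ s, f c) := by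
  classical
  induction s using Finset.induction_on with
  | empty => simp [P_zero]
  | insert a s ha ih =>
    rw [sum_insert ha, sum_insert ha]
    calc P (f a) + ∑ c ∈ s, P (f c) ≤ P (f a) + P (∑ c ∈ s, f c) := Nat.add_le_add_left ih _
      _ ≤ P (f a + ∑ c ∈ s, f c) := P_superadd _ _

end KK

namespace Graph

open Finset

section CompSet

variable {V : Type*} [Fintype V] (G : SimpleGraph V)

/-- The vertex set of the connected component `c`. -/
noncomputable def compSet (c : G.ConnectedComponent) : Finset V := by
  classical exact univ.filter (fun v => G.connectedComponentMk v = c)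

/-- Membership in `compSet`. -/
theorem mem_compSet {c : G.ConnectedComponent} {v : V} :
    v ∈ compSet G c ↔ G.connectedComponentMk v = c := by
  simp [compSet]

/-- Every component has a vertex. -/
theorem compSet_nonempty (c : G.ConnectedComponent) : (compSet G c).Nonempty := by
  induction c using SimpleGraph.ConnectedComponent.ind with
  | h v => exact ⟨v, (mem_compSet G).2 rfl⟩

/-- The vertex set of a component satisfies the cut criterion. -/
theorem isConn_compSet (c : G.ConnectedComponent) : IsConn G (compSet G c) := by
  intro A hA hAne hAc
  obtain ⟨a, ha⟩ := hAne
  obtain ⟨b, hbc, hbA⟩ := Finset.exists_of_ssubset (lt_of_le_of_ne hA hAc)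
  have hreach : G.Reachable a b := by
    apply SimpleGraph.ConnectedComponent.exact
    rw [(mem_compSet G).1 (hA ha), (mem_compSet G).1 hbc]
  obtain ⟨p⟩ := hreach
  obtain ⟨d, -, hd1, hd2⟩ :=
    p.exists_boundary_dart (A : Set V) (by simpa using ha) (by simpa using hbA)
  refine ⟨d.fst, by simpa using hd1, d.snd, ?_, by simpa using hd2, d.adj⟩
  rw [mem_compSet, ← SimpleGraph.ConnectedComponent.connectedComponentMk_eq_of_adj d.adj]
  exact (mem_compSet G).1 (hA (by simpa using hd1))

end CompSet

section Components

variable {V : Type*} [DecidableEq V] [Fintype V] (G : SimpleGraph V) [DecidableRel G.Adj]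

/-- A clique with at least one vertex lies inside one component. -/
theorem cliques_subset_compSet {S : Finset V} {k : ℕ} (hk : 1 ≤ k) {t : Finset V}
    (ht : t ∈ cliques G S k) : ∃ c, t ⊆ compSet G c := by
  rw [mem_cliques] at ht
  obtain ⟨-, htc, htcl⟩ := ht
  obtain ⟨v, hv⟩ : t.Nonempty := by rw [← card_pos, htc]; exact hk
  refine ⟨G.connectedComponentMk v, fun w hw => ?_⟩
  rw [mem_compSet]
  by_cases hvw : v = w
  · rw [hvw]
  · exact (SimpleGraph.ConnectedComponent.connectedComponentMk_eq_of_adj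
      (htcl (by exact_mod_cast hv) (by exact_mod_cast hw) hvw)).symm

/-- The `k`-cliques (`k ≥ 1`) of `G` are the disjoint union of the `k`-cliques of its components. -/
theorem card_cliques_univ_eq_sum {k : ℕ} (hk : 1 ≤ k) :
    (cliques G univ k).card = ∑ c, (cliques G (compSet G c) k).card := by
  classical
  rw [← card_biUnion]
  · congr 1
    ext t
    simp only [mem_biUnion, mem_univ, true_and, mem_cliques, subset_univ]
    constructor
    · rintro ⟨htc, htcl⟩
      obtain ⟨c, hc⟩ :=
        cliques_subset_compSet G hk (S := univ) ((mem_cliques G).2 ⟨subset_univ _, htc, htcl⟩)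
      exact ⟨c, hc, htc, htcl⟩
    · rintro ⟨c, -, htc, htcl⟩
      exact ⟨htc, htcl⟩
  · intro c _ c' _ hcc'
    change Disjoint (cliques G (compSet G c) k) (cliques G (compSet G c') k)
    rw [Finset.disjoint_left]
    intro t ht ht'
    rw [mem_cliques] at ht ht'
    obtain ⟨v, hv⟩ : t.Nonempty := by rw [← card_pos, ht.2.1]; exact hk
    have h1 := (mem_compSet G).1 (ht.1 hv)
    have h2 := (mem_compSet G).1 (ht'.1 hv)
    exact hcc' (h1.symm.trans h2)

/-- The components partition the vertices: `Σ_c #(compSet c) = #V`. -/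
theorem sum_card_compSet : ∑ c, (compSet G c).card = Fintype.card V := by
  classical
  rw [← card_univ, card_eq_sum_card_fiberwise (f := G.connectedComponentMk) (t := univ)
    (fun _ _ => mem_univ _)]
  refine sum_congr rfl (fun c _ => ?_)
  simp [compSet]

/-- **THE GRAPHIC CLOSED FORM, ALL FINITE SIMPLE GRAPHS.** With `e` edges, `n` vertices and `c` connected
components, the number of triangles is at most `P_KK(e + c − n)`, the cyclomatic number `e − n + c`. -/
theorem card_triangles_le_P_general [Fintype G.edgeSet] :
    (G.cliqueFinset 3).card ≤
      KK.P (G.edgeFinset.card + Fintype.card G.ConnectedComponent - Fintype.card V) := by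
  classical
  have hc : ∀ c : G.ConnectedComponent,
      (compSet G c).card ≤ (cliques G (compSet G c) 2).card + 1 ∧
        (cliques G (compSet G c) 3).card ≤
          KK.P ((cliques G (compSet G c) 2).card + 1 - (compSet G c).card) :=
    fun c => main_aux G _ _ rfl (isConn_compSet G c) (compSet_nonempty G c)
  rw [← cliques_univ_eq_cliqueFinset, card_edgeFinset_eq_card_cliques_two,
    card_cliques_univ_eq_sum G (by norm_num : 1 ≤ 3), card_cliques_univ_eq_sum G (by norm_num : 1 ≤ 2)]
  calc ∑ c, (cliques G (compSet G c) 3).card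
      ≤ ∑ c, KK.P ((cliques G (compSet G c) 2).card + 1 - (compSet G c).card) :=
        sum_le_sum (fun c _ => (hc c).2)
    _ ≤ KK.P (∑ c, ((cliques G (compSet G c) 2).card + 1 - (compSet G c).card)) := KK.sum_P_le _ _
    _ = KK.P (∑ c, (cliques G (compSet G c) 2).card + Fintype.card G.ConnectedComponent -
          Fintype.card V) := by
      congr 1
      have h1 : ∑ c, ((cliques G (compSet G c) 2).card + 1 - (compSet G c).card) +
          ∑ c, (compSet G c).card = ∑ c, ((cliques G (compSet G c) 2).card + 1) := by
        rw [← sum_add_distrib]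
        apply sum_congr rfl
        intro c _
        have := (hc c).1
        omega
      rw [sum_add_distrib, sum_const, card_univ, smul_eq_mul, mul_one, sum_card_compSet] at h1
      omega

end Components

end Graph

end TriangleCap

end PercRepro
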